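import Summits.BirchSwinnertonDyer.BirchSwinnertonDyer.Theses.PrintX6
import Summits.BirchSwinnertonDyer.BirchSwinnertonDyer.Theorems.PrintX6KobayashiUpperHalf
import Summits.BirchSwinnertonDyer.BirchSwinnertonDyer.Theorems.PrintX6DescentCertificateRoadOneSided
import HarnessLib

/-!
# Print tier P-X6 (cell `bsd-print-x6`, seat p4): the explicit `p`-descent certificate road ON THE ROUTE'S OWN
# INPUT LIST — `PublishedInputsX6` (route `PrintX6`, item `UpperHalfX6` PROVED) + ONE certificate line ⟹ `BSD(E,p)`
# on every non-unit cell of the leaf `ClassX6 ∧ r_an = 0`, with NO Wuthrich-Prop-21 binder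

PARTITION currency (D-0054): leaf A6 = X6 ∧ r_an = 0 (`WAllCornerX6r0`); PER PAIR (one certificate line per curve);
NOT a class theorem; BEYOND-PRINT THEOREM: **NO**. Strategy sentence of this seat (director-bsd D-0131 (2), verbatim):
«explicit p-descent certificate road: Sel_p(E/ℚ) exactly (p-isogeny or full p-descent, two engines) + Kato's upper
bound ⇒ #Ш[p^∞] = p^{ord_p Ш_an} on the non-unit cells».

WHAT IS NEW. The certificate consumers of record — this seat's `X6.bsdp_rankZero_of_card_selmerGroup_primePow`
(p532160, exact count), `X6.bsdp_rankZero_of_pow_le_card_selmerGroup_primePow` (p533203, one-sided), and b2b-bsdres'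
`Supersingular.X6.bsdp_rankZero_of_casselsTate_of_selmerGroup_ne_bot` (p212413, the consumer of the 3 909-row
beyond-window census `T-KATO-CT`, referee A R193.5, of which the X6 rows are this leaf's `p = 3` non-unit cells) —
all read the UPPER half `ord_p #Ш ≤ ord_p #Ш_an` from Wuthrich 2014 Prop. 21 (`hW : sha_dvd_analyticSha`; provenance
flag `R-WU14-P21-SS` of this cell's referee: the supersingular axis of Prop. 21 is one printed sentence). Route
`PrintX6` exists precisely to re-source that upper half: its item `UpperHalfX6` is PROVED (`upperHalfX6_proof`,
p535414 — Kobayashi 2003 Thm. 4.1 integral clause + Thm. 1.2 + B. D. Kim 2013 Cor. 3.15 + period units + Pollack +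
modularity + GZK, i.e. from the route's input conjunction `PublishedInputsX6`, item 20302, eight refereed facts by
name + Wuthrich Lemma 20 PROVED). This file puts the certificate road on THAT trust base: every theorem below has
binders ⊆ {`PublishedInputsX6`, Cassels–Tate `exists_casselsTate_pairing` (only in §3), the certificate line}, so a
per-pair closure of a non-unit A6 cell and the route's class-wide assembly now consume THE SAME published inputs —
the census rows are literally instances of the route's two cruxes `EisensteinHalfFiveLe` / `EisensteinHalfAtThree`
decided one cell at a time (`eisensteinHalf_cell_of_card_selmerGroup_primePow`, p535256) and closed by the route's
own upper half.

CONTENTS. §1 glue: inputs + ANY typed lower half at a leaf pair ⇒ `BSDp` (`missingPPartAt_of_lower_of_upper`,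
`bsdp_of_missingPPartAt`; the upper half is taken from the route-independent module `PrintX6KobayashiUpperHalf`, the
very chain of `upperHalfX6_proof`, so that this file imports the route file once and no other Theses-dependent
module). §2 the descent sockets on inputs: one-sided `p^m ≤ #Sel^(p^k)(E/ℚ)` (the GRH-free shape:
exhibited, exactly verified, independent Selmer elements — Schaefer–Stoll), exact `#Sel^(p^k) = p^m`, first descent
`k = 1`, exactness-for-free and the iff (the certificate is exactly as strong as `BSD(E,p)` pair by pair). §3 the
Cassels–Tate socket on inputs: `Sel^(p)(E/ℚ) ≠ 0` + `ord_p #Ш_an ≤ 2` (the shape of EVERY A6 census row of record: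
`ord_3 #Ш_an = 2`, two-engine `dim_𝔽₃ Sel^(3) = 2`). §4 the `p = 3` display shapes. §5 every census row is one CELL of
the cruxes (GZK / CT only). (The CLASS-WIDE counterpart of §5 — the descent modulo the inputs
and a one-sign Eisenstein divisibility, skeleton stub 2 `stub_signedDescentRankZero` of BOTH cruxes, same name and signature —
is landed once, as `PrintX6.EisensteinHalfFiveLe.stub_signedDescentRankZero`, p541769; the gate's dedup forbids a per-item copy.) Class-free lower halves are the
tree's (`missingLowerBoundAt_of_pow_le_card_selmerGroup_primePow`, `…_of_casselsTate_of_selmerGroup_ne_bot`);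
`p ∤ #E(ℚ)_tors` is discharged from `ClassX6.irr` (Serre 1972 Prop. 12 + Mazur).

CENSUS OF RECORD this file re-bases (nothing recomputed, no new numerics; tables cited by name): A6 @ 3, N < 2·10⁴ —
12 cells, two-engine EXACT `dim Sel^(3) = 2` (`Supersingular/X678DescentRecords.lean`, kit j091546; referee A
R302/R303; this seat's CT-free twins p533853); A6 @ 3, 2·10⁴ ≤ N < 5·10⁵ — the X6 rows of `T-KATO-CT` (two-engine
LOWER-BOUND `dim Sel^(3) ≥ 2`, same subspace, records p226699…p226914, booked R193.5); A6 @ p ≥ 5 — Kurihara numbers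
(Kim 2026) / visibility (22678e1), not descent. The class-wide statement (cruxes 20276 / 20285 = the Eisenstein half
of Kobayashi's signed main conjecture, K3 stmt-19000) is NOT reached by any certificate — unchanged.

References: Kobayashi 2003 Thm. 1.2 / 4.1 [Kobayashi2003]; B. D. Kim 2013 Cor. 3.15 [BDKim2013]; Silverman AEC X.4.2,
X.4.14 [SilvermanAEC2009]; Cassels 1962 [Cassels1962ArithmeticIV]; Schaefer–Stoll 2004 [SchaeferStoll2004];
Miller 2011 Def. 1.1 [Miller2011LMS]; cell files HOME/PLAN.md v1.1 (p4), HOME/REFEREE.md §0 R-0.8.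
-/

set_option autoImplicit false
set_option linter.dupNamespace false

noncomputable section

open scoped Classical

open WeierstrassCurve Literature.NumberTheory.EllipticCurves
  Literature.NumberTheory.EllipticCurves.Rank1Residual
  Literature.NumberTheory.EllipticCurves.Rank1Residual.Typed
  Summit.BirchSwinnertonDyer.Rank1Residual.Supersingular
  Summit.BirchSwinnertonDyer.BirchSwinnertonDyer.Theses.PrintX6

namespace Summit.BirchSwinnertonDyer.BirchSwinnertonDyer.Theorems.PrintX6

variable (W : WeierstrassCurve ℚ) [W.IsElliptic] [W.IsGloballyMinimal] (p : ℕ) [hp : Fact p.Prime]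

/-! ### §1 Glue: the route's inputs + any typed lower half at a leaf pair -/

/-- **Inputs + lower half ⇒ `BSD(E,p)` at a leaf pair.** `PublishedInputsX6`, `p ≠ 2`, `ClassX6 W p`,
`ord_{s=1} L(E,s) = 0` and the typed LOWER half `MissingLowerBoundAt W p` (from whatever source: a certificate, a
crux) ⇒ Miller's `BSDp W p` — the upper half is the route's PROVED item `UpperHalfX6` (`upperHalfX6_proof`, i.e.
`X6.missingUpperBoundAt_rankZero_of_thm41` on conjuncts 2, 1, 3, 4, 5, 7, 8, 9 of the inputs; conjunct 6, Wuthrich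
Lemma 20, is unused because 3-adic surjectivity on X6 is a tree theorem), the two halves make `MissingPPartAt`, and
GZK (conjunct 9) finishes. No Wuthrich Prop. 21. [cite: Kobayashi2003, Thm. 4.1 (p. 8) and Thm. 1.2 (p. 2)]
[cite: BDKim2013, Cor. 3.15 (p. 199)] [cite: GreenbergVatsal2000, §3, Remark 3.4] [cite: Miller2011LMS, §1 and Def. 1.1] -/
theorem X6.bsdp_rankZero_of_publishedInputsX6_of_missingLowerBoundAt (hPub : PublishedInputsX6)
    (hp2 : p ≠ 2) (hX : ClassX6 W p) (hr : W.analyticRank = 0) (hlow : MissingLowerBoundAt W p) :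
    BSDp W p := by
  obtain ⟨h12, h41, hKim, h5, h3, -, hmod, hmod', hGZK⟩ := hPub
  exact bsdp_of_missingPPartAt W p hGZK (by omega)
    (missingPPartAt_of_lower_of_upper W p hlow
      (X6.missingUpperBoundAt_rankZero_of_thm41 W p h41 h12 hKim h5 h3 hmod hmod' hGZK hp2 hX hr))

/-! ### §2 The descent sockets on the route's inputs (Cassels–Tate-free) -/

/-- **Leaf A6, odd `p`: `BSD(E,p)` from the route's inputs + a ONE-SIDED prime-power descent certificate.**
`PublishedInputsX6`, a leaf pair, `#Ш_an = q`, and `p^m ≤ #Sel^(p^k)(E/ℚ)` with `ord_p q ≤ m` (e.g. `m` EXHIBITED,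
exactly verified, independent everywhere-locally-soluble `p^k`-coverings — GRH-free) ⇒ `BSDp W p`. Lower half:
`missingLowerBoundAt_of_pow_le_card_selmerGroup_primePow` (Silverman X.4.2: `Sel^(p^k) ≅ Ш[p^k]` at rank `0` without
rational `p`-torsion — `ClassX6.irr` + Mazur —, Lagrange); upper half: the route's. Per pair; not a class theorem.
[cite: SilvermanAEC2009, Thm X.4.2(a)] [cite: Kobayashi2003, Thm. 4.1 (p. 8)] [cite: BDKim2013, Cor. 3.15 (p. 199)]
[cite: Miller2011LMS, §1 and Def. 1.1] -/
theorem X6.bsdp_rankZero_of_publishedInputsX6_of_pow_le_card_selmerGroup_primePow (hPub : PublishedInputsX6)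
    (hp2 : p ≠ 2) (hX : ClassX6 W p) (hr : W.analyticRank = 0) {k m : ℕ}
    (hle : p ^ m ≤ Nat.card (W.selmerGroup ((p ^ k : ℕ) : ℤ)))
    {q : ℚ} (hq : shaAn W = (q : ℂ)) (hv : padicValRat p q ≤ m) : BSDp W p :=
  X6.bsdp_rankZero_of_publishedInputsX6_of_missingLowerBoundAt W p hPub hp2 hX hr
    (missingLowerBoundAt_of_pow_le_card_selmerGroup_primePow W p hPub.2.2.2.2.2.2.2.2 hr
      (not_dvd_torsionOrder_of_irr W p (ClassX6.irr W p hp2 hX)) hle hq hv)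

/-- **Leaf A6, odd `p`: `BSD(E,p)` from the route's inputs + an EXACT prime-power descent certificate**
`#Sel^(p^k)(E/ℚ) = p^m` with `ord_p #Ш_an ≤ m` (the strategy sentence's «Sel exactly + upper bound» with Kato's
bound read through Kobayashi Thm. 4.1 / Kim Cor. 3.15 instead of Wuthrich Prop. 21).
[cite: SilvermanAEC2009, Thm X.4.2(a)] [cite: Kobayashi2003, Thm. 4.1 (p. 8)] [cite: BDKim2013, Cor. 3.15 (p. 199)]
[cite: Miller2011LMS, §1 and Def. 1.1] -/
theorem X6.bsdp_rankZero_of_publishedInputsX6_of_card_selmerGroup_primePow (hPub : PublishedInputsX6)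
    (hp2 : p ≠ 2) (hX : ClassX6 W p) (hr : W.analyticRank = 0) {k m : ℕ}
    (hcard : Nat.card (W.selmerGroup ((p ^ k : ℕ) : ℤ)) = p ^ m)
    {q : ℚ} (hq : shaAn W = (q : ℂ)) (hv : padicValRat p q ≤ m) : BSDp W p :=
  X6.bsdp_rankZero_of_publishedInputsX6_of_pow_le_card_selmerGroup_primePow W p hPub hp2 hX hr hcard.ge hq hv

/-- **The first-descent instance (`k = 1`) on the route's inputs**: `p^m ≤ #Sel^(p)(E/ℚ)`, `ord_p #Ш_an ≤ m` ⇒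
`BSD(E,p)` — the shape of every A6 census row of record (`m = 2`). [cite: SilvermanAEC2009, Thm X.4.2(a)]
[cite: Kobayashi2003, Thm. 4.1 (p. 8)] [cite: BDKim2013, Cor. 3.15 (p. 199)] [cite: Miller2011LMS, §1 and Def. 1.1] -/
theorem X6.bsdp_rankZero_of_publishedInputsX6_of_pow_le_card_selmerGroup (hPub : PublishedInputsX6)
    (hp2 : p ≠ 2) (hX : ClassX6 W p) (hr : W.analyticRank = 0) {m : ℕ}
    (hle : p ^ m ≤ Nat.card (W.selmerGroup (p : ℤ)))
    {q : ℚ} (hq : shaAn W = (q : ℂ)) (hv : padicValRat p q ≤ m) : BSDp W p :=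
  X6.bsdp_rankZero_of_publishedInputsX6_of_pow_le_card_selmerGroup_primePow W p hPub hp2 hX hr (k := 1)
    (by rw [pow_one]; exact hle) hq hv

/-- **Exactness for free on the route's inputs.** A one-sided certificate `p^m ≤ #Sel^(p^k)(E/ℚ)` at a leaf cell
with `ord_p #Ш_an = m` and `k ≥ m` FORCES `#Sel^(p^k)(E/ℚ) = p^m`: `BSD(E,p)` holds (previous theorem), so
`ord_p #Ш = m ≤ k` and the exact count is `X6.card_selmerGroup_primePow_eq_of_bsdp` (GZK only). So the «exact» flag
of a descent row is a THEOREM once `m` classes are exhibited — on the route's inputs as on Wuthrich's.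
[cite: SilvermanAEC2009, Thm X.4.2(a)] [cite: Kobayashi2003, Thm. 4.1 (p. 8)] [cite: Miller2011LMS, Def. 1.1] -/
theorem X6.card_selmerGroup_primePow_eq_of_publishedInputsX6_of_pow_le (hPub : PublishedInputsX6)
    (hp2 : p ≠ 2) (hX : ClassX6 W p) (hr : W.analyticRank = 0) {k m : ℕ}
    (hle : p ^ m ≤ Nat.card (W.selmerGroup ((p ^ k : ℕ) : ℤ)))
    {q : ℚ} (hq : shaAn W = (q : ℂ)) (hv : padicValRat p q = m) (hk : m ≤ k) :
    Nat.card (W.selmerGroup ((p ^ k : ℕ) : ℤ)) = p ^ m := by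
  have hbsd : BSDp W p :=
    X6.bsdp_rankZero_of_publishedInputsX6_of_pow_le_card_selmerGroup_primePow W p hPub hp2 hX hr hle hq hv.le
  have hGZK : rank_eq_analyticRank_of_analyticRank_le_one := hPub.2.2.2.2.2.2.2.2
  haveI : Finite W.sha := (hGZK W (by omega)).2
  have hordm : padicValNat p W.shaOrder = m := by
    obtain ⟨-, -, q', hq', hval⟩ := hbsd
    have hqq : q' = q := by exact_mod_cast hq'.symm.trans hq
    subst hqq
    have h1 : (padicValNat p W.shaOrder : ℤ) = padicValRat p q' := by
      rw [hval, WeierstrassCurve.shaOrder, padicValNat_card_addPrimaryComponent]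
    have h2 : (padicValNat p W.shaOrder : ℤ) = (m : ℤ) := h1.trans hv
    exact_mod_cast h2
  obtain ⟨m', hcard, hv'⟩ :=
    X6.card_selmerGroup_primePow_eq_of_bsdp W p hGZK hp2 hX hr hbsd hq (k := k) (by omega)
  have hmm : m' = m := by exact_mod_cast hv'.symm.trans hv
  rw [hcard, hmm]

/-- **Leaf A6, odd `p`, on the route's inputs: `BSD(E,p)` ⟺ a one-sided prime-power descent certificate matching
`ord_p #Ш_an`** (`#Ш_an = q`): `BSDp W p ↔ ∃ k m, p^m ≤ #Sel^(p^k)(E/ℚ) ∧ ord_p q = m`. (→) GZK alone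
(`X6.card_selmerGroup_primePow_eq_of_bsdp` at `k = ord_p #Ш`); (←) the one-sided socket. The certificate road is
EXACTLY as strong as the leaf's obligation pair by pair; what it does not supply is the UNIFORM reason — the
Eisenstein half (cruxes `EisensteinHalfFiveLe` / `EisensteinHalfAtThree`). [cite: SilvermanAEC2009, Thm X.4.2(a)]
[cite: Kobayashi2003, Thm. 4.1 (p. 8)] [cite: BDKim2013, Cor. 3.15 (p. 199)] [cite: Miller2011LMS, §1 and Def. 1.1] -/
theorem X6.bsdp_rankZero_iff_exists_pow_le_card_selmerGroup_primePow_of_publishedInputsX6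
    (hPub : PublishedInputsX6) (hp2 : p ≠ 2) (hX : ClassX6 W p) (hr : W.analyticRank = 0)
    {q : ℚ} (hq : shaAn W = (q : ℂ)) :
    BSDp W p ↔
      ∃ k m : ℕ, p ^ m ≤ Nat.card (W.selmerGroup ((p ^ k : ℕ) : ℤ)) ∧ padicValRat p q = m := by
  constructor
  · intro hbsd
    obtain ⟨m, hcard, hv⟩ :=
      X6.card_selmerGroup_primePow_eq_of_bsdp W p hPub.2.2.2.2.2.2.2.2 hp2 hX hr hbsd hq
        (k := padicValNat p W.shaOrder) le_rfl
    exact ⟨_, m, hcard.ge, hv⟩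
  · rintro ⟨k, m, hle, hv⟩
    exact X6.bsdp_rankZero_of_publishedInputsX6_of_pow_le_card_selmerGroup_primePow W p hPub hp2 hX hr hle hq
      hv.le

/-- **The exact order of `Ш[p^∞]` on the route's inputs** (the strategy sentence's conclusion
`#Ш(E/ℚ)[p^∞] = p^{ord_p #Ш_an}`): inputs + a leaf pair + `p^m ≤ #Sel^(p^k)(E/ℚ)` + `ord_p #Ш_an = m` ⇒ the
`p`-primary part of `Ш(E/ℚ)` has order `p^m`. [cite: Kobayashi2003, Thm. 4.1 (p. 8)]
[cite: SilvermanAEC2009, Thm X.4.2(a)] [cite: Miller2011LMS, Def. 1.1 (arXiv:1010.2431 p. 3)] -/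
theorem X6.card_primaryComponent_sha_eq_of_publishedInputsX6_of_pow_le (hPub : PublishedInputsX6)
    (hp2 : p ≠ 2) (hX : ClassX6 W p) (hr : W.analyticRank = 0) {k m : ℕ}
    (hle : p ^ m ≤ Nat.card (W.selmerGroup ((p ^ k : ℕ) : ℤ)))
    {q : ℚ} (hq : shaAn W = (q : ℂ)) (hv : padicValRat p q = m) :
    Nat.card (AddCommGroup.primaryComponent W.sha p) = p ^ m := by
  obtain ⟨-, hfin, q', hq', hval⟩ :=
    X6.bsdp_rankZero_of_publishedInputsX6_of_pow_le_card_selmerGroup_primePow W p hPub hp2 hX hr hle hq hv.le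
  haveI := hfin
  have hqq : q' = q := by exact_mod_cast hq'.symm.trans hq
  subst hqq
  obtain ⟨n, hn⟩ := exists_card_addPrimaryComponent_eq_pow (A := W.sha) p
  rw [hn, padicValNat.prime_pow, hv] at hval
  have hnm : n = m := by exact_mod_cast hval.symm
  rw [hn, hnm]

/-! ### §3 The Cassels–Tate socket on the route's inputs (the shape of the census rows of record) -/

/-- **Leaf A6, odd `p`, `ord_p #Ш_an ≤ 2`: `BSD(E,p)` from the route's inputs + Cassels–Tate + the native
certificate line `Sel^(p)(E/ℚ) ≠ 0`.** Binders by name: `PublishedInputsX6` (upper half via `upperHalfX6_proof`,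
GZK), Cassels–Tate `hCT` (Cassels 1962 / Silverman X.4.14: `#Ш` is a square once finite); `p ∤ #E(ℚ)_tors` from
`ClassX6.irr`; lower half `Supersingular.missingLowerBoundAt_of_casselsTate_of_selmerGroup_ne_bot` (b2b-bsdres).
This is the row shape `T-KATO-CT` of the beyond-window census (two-engine lower-bound `3`-descents, referee A
R193.5) and of the twelve in-window A6 cells, with Kato's bound re-sourced to the route. Per pair.
[cite: SilvermanAEC2009, Thm. X.4.14] [cite: Kobayashi2003, Thm. 4.1 (p. 8)] [cite: BDKim2013, Cor. 3.15 (p. 199)]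
[cite: Serre1972, §1.11 Prop. 12] [cite: Miller2011LMS, §1 and Def. 1.1] -/
theorem X6.bsdp_rankZero_of_publishedInputsX6_of_casselsTate_of_selmerGroup_ne_bot (hPub : PublishedInputsX6)
    (hCT : exists_casselsTate_pairing (K := ℚ))
    (hp2 : p ≠ 2) (hX : ClassX6 W p) (hr : W.analyticRank = 0)
    {q : ℚ} (hq : shaAn W = (q : ℂ)) (hv : padicValRat p q ≤ 2)
    (hSel : W.selmerGroup (p : ℤ) ≠ ⊥) : BSDp W p :=
  X6.bsdp_rankZero_of_publishedInputsX6_of_missingLowerBoundAt W p hPub hp2 hX hr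
    (missingLowerBoundAt_of_casselsTate_of_selmerGroup_ne_bot W p hCT hPub.2.2.2.2.2.2.2.2 hr
      (not_dvd_torsionOrder_of_irr W p (ClassX6.irr W p hp2 hX)) hq hv hSel)

/-! ### §4 The `p = 3` display shapes (A6 @ 3: `a₃ = 0` inside `ClassX6 W 3`, `#Ш_an = 9·unit`) -/

omit hp in
/-- **A6 @ 3, CT-free display shape on the route's inputs**: `ClassX6 W 3`, `ord_{s=1} L(E,s) = 0`, `#Ш_an = q`
with `ord_3 q ≤ 2`, and `9 ≤ #Sel^(3)(E/ℚ)` (two exhibited independent `3`-Selmer elements — the content of every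
two-engine A6 @ 3 descent row, exact or lower-bound) ⇒ `BSD(E,3)`. [cite: SilvermanAEC2009, Thm X.4.2(a)]
[cite: Kobayashi2003, Thm. 4.1 (p. 8)] [cite: BDKim2013, Cor. 3.15 (p. 199)] [cite: Miller2011LMS, §1 and Def. 1.1] -/
theorem X6.bsdp_three_of_publishedInputsX6_of_nine_le_card_selmerGroup (hPub : PublishedInputsX6)
    (hX : ClassX6 W 3) (hr : W.analyticRank = 0)
    (hle : 9 ≤ Nat.card (W.selmerGroup (3 : ℤ)))
    {q : ℚ} (hq : shaAn W = (q : ℂ)) (hv : padicValRat 3 q ≤ 2) : BSDp W 3 :=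
  haveI : Fact (Nat.Prime 3) := ⟨Nat.prime_three⟩
  X6.bsdp_rankZero_of_publishedInputsX6_of_pow_le_card_selmerGroup W 3 hPub (by decide) hX hr (m := 2)
    (by norm_num; exact_mod_cast hle) (by exact_mod_cast hq) (by exact_mod_cast hv)

omit hp in
/-- **A6 @ 3, Cassels–Tate display shape on the route's inputs**: `ClassX6 W 3`, `ord_{s=1} L(E,s) = 0`,
`#Ш_an = q` with `ord_3 q ≤ 2`, Cassels–Tate, and `Sel^(3)(E/ℚ) ≠ 0` ⇒ `BSD(E,3)` — the `T-KATO-CT` row shape with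
the route's upper half. [cite: SilvermanAEC2009, Thm. X.4.14] [cite: Kobayashi2003, Thm. 4.1 (p. 8)]
[cite: BDKim2013, Cor. 3.15 (p. 199)] [cite: Miller2011LMS, §1 and Def. 1.1] -/
theorem X6.bsdp_three_of_publishedInputsX6_of_casselsTate_of_selmerGroup_ne_bot (hPub : PublishedInputsX6)
    (hCT : exists_casselsTate_pairing (K := ℚ))
    (hX : ClassX6 W 3) (hr : W.analyticRank = 0)
    {q : ℚ} (hq : shaAn W = (q : ℂ)) (hv : padicValRat 3 q ≤ 2)
    (hSel : W.selmerGroup (3 : ℤ) ≠ ⊥) : BSDp W 3 :=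
  haveI : Fact (Nat.Prime 3) := ⟨Nat.prime_three⟩
  X6.bsdp_rankZero_of_publishedInputsX6_of_casselsTate_of_selmerGroup_ne_bot W 3 hPub hCT (by decide) hX hr
    (by exact_mod_cast hq) (by exact_mod_cast hv) (by exact_mod_cast hSel)

/-! ### §5 Every census row is one CELL of the route's Eisenstein-half cruxes -/

/-- **Crux conclusion at one cell from a ONE-SIDED certificate (GZK only).** At an X6 pair with odd `p`,
`ord_{s=1} L(E,s) = 0`, `#Ш_an = q`, and `p^m ≤ #Sel^(p^k)(E/ℚ)` with `ord_p q ≤ m`: `ord_p q ≤ ord_p #Ш(E/ℚ)` — the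
common conclusion of `EisensteinHalfFiveLe` / `EisensteinHalfAtThree` AT THAT CELL (the one-sided twin of
`eisensteinHalf_cell_of_card_selmerGroup_primePow`, p535256). No upper bound, no Cassels–Tate; `E(ℚ)[p] = 0` by
`ClassX6.irr`. Per pair; the class-wide cruxes are untouched. [cite: SilvermanAEC2009, Thm X.4.2(a)]
[cite: Miller2011LMS, Def. 1.1 (arXiv:1010.2431 p. 3)] -/
theorem eisensteinHalf_cell_of_pow_le_card_selmerGroup_primePow
    (hGZK : rank_eq_analyticRank_of_analyticRank_le_one)
    (hp2 : p ≠ 2) (hX : ClassX6 W p) (hr : W.analyticRank = 0) {k m : ℕ}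
    (hle : p ^ m ≤ Nat.card (W.selmerGroup ((p ^ k : ℕ) : ℤ)))
    {q : ℚ} (hq : shaAn W = (q : ℂ)) (hv : padicValRat p q ≤ m) :
    padicValRat p q ≤ (padicValNat p W.shaOrder : ℤ) := by
  obtain ⟨q', hq', hle'⟩ := missingLowerBoundAt_of_pow_le_card_selmerGroup_primePow W p hGZK hr
    (not_dvd_torsionOrder_of_irr W p (ClassX6.irr W p hp2 hX)) hle hq hv
  have hqq : q' = q := by exact_mod_cast hq'.symm.trans hq
  subst hqq
  exact hle'

/-- **Crux conclusion at one cell from the Cassels–Tate socket (CT + GZK only).** At an X6 pair with odd `p`,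
`ord_{s=1} L(E,s) = 0`, `#Ш_an = q` with `ord_p q ≤ 2`, and `Sel^(p)(E/ℚ) ≠ 0`: `ord_p q ≤ ord_p #Ш(E/ℚ)` — so EVERY
row of the census of record (A6 @ 3: `ord_3 #Ш_an = 2`, two-engine `Sel^(3) ≠ 0`, N < 5·10⁵) is an instance of the
residual crux `EisensteinHalfAtThree` decided at its own cell. [cite: SilvermanAEC2009, Thm. X.4.14]
[cite: Miller2011LMS, Def. 1.1 (arXiv:1010.2431 p. 3)] -/
theorem eisensteinHalf_cell_of_casselsTate_of_selmerGroup_ne_bot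
    (hCT : exists_casselsTate_pairing (K := ℚ)) (hGZK : rank_eq_analyticRank_of_analyticRank_le_one)
    (hp2 : p ≠ 2) (hX : ClassX6 W p) (hr : W.analyticRank = 0)
    {q : ℚ} (hq : shaAn W = (q : ℂ)) (hv : padicValRat p q ≤ 2) (hSel : W.selmerGroup (p : ℤ) ≠ ⊥) :
    padicValRat p q ≤ (padicValNat p W.shaOrder : ℤ) := by
  obtain ⟨q', hq', hle'⟩ := missingLowerBoundAt_of_casselsTate_of_selmerGroup_ne_bot W p hCT hGZK hr
    (not_dvd_torsionOrder_of_irr W p (ClassX6.irr W p hp2 hX)) hq hv hSel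
  have hqq : q' = q := by exact_mod_cast hq'.symm.trans hq
  subst hqq
  exact hle'

end Summit.BirchSwinnertonDyer.BirchSwinnertonDyer.Theorems.PrintX6

end
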